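import Literature.MathematicalPhysics.QuantumFieldTheory.Balaban1983to89.B15TreeGaugeT0
import Literature.MathematicalPhysics.QuantumFieldTheory.Balaban1983to89.B15TreeGaugeT0LevelChange
import Literature.MathematicalPhysics.QuantumFieldTheory.Balaban1983to89.B15Claim196TreeGauge

/-!
# `Balaban1983to89.B15Claim196T0` — T. Bałaban, *Large field renormalization. I. The basic step of the 𝐑 operation*, Commun. Math. Phys. **122** (1989) 175–202 [Balaban1989LargeFieldI], p. 196: the claim *"We can prove that it satisfies |V′ − 1| < O(1)M²NR_k⁴ε_k on 𝐁₀"* for the fluctuation field `V′ = V″V₀⁻¹` in the tree gauge `T₀` — PROVED on ALL of `𝐁₀` (every bond joining sites of the layers `Λ ∖ Pᵐ`, including the bonds joining two consecutive layers), single-scale model (PART 6 of this unit's transport reading)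

statement-level skeleton of published theorems with citation tags; proofs where landed; nothing here is a claim about the Yang–Mills mass gap

PDF held: `paper:balaban1989-cmp122-large-field-i` (journal page = PDF page + 174; pp. 195–196 = PDF pp. 21–22, text layer
re-read for this file; p. 177 = PDF p. 3 (condition (i)), p. 193 = PDF p. 19).

WHAT IS REPRODUCED (mega-formalization `lit-balaban`, HOME `run/shared/lean/pub/lit-balaban/`, Phase-2 seat p26, generation 5;
SKELETON row **B15.Claim@196** (r12), typed leaf `B15.PrelimIntegrations.IneqV196 dev C M N R_k ε_k := dev < C·M²·N·R_k⁴·ε_k`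
(p239014); referee ref-5).  P. 195, (1.81): *"V″ = V′V₀ on Λ₀ … More precisely the equality is on the set 𝐁₀"*.  P. 196,
verbatim: *"The union of the above described tree graphs and bonds is denoted by T₀. It is a tree graph in 𝐁₀, fixing
completely a gauge in this set. … The regularity conditions for V″, V₀, and the gauge fixing for V′ introduce restrictions
on this field. We can prove that it satisfies |V′ − 1| < O(1)M²NR_k⁴ε_k on 𝐁₀."*  NO PROOF IS PRINTED; the proof below is
this seat's, by the mechanism of Lemma 1 of [14] (invoked for the same configuration on [Balaban1989LargeFieldII] p. 382),
extending the generation-4 model instance `B15Claim196TreeGauge` (ONE annulus `P₁∖P₂`) to the whole chain.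

THE MODEL (PART 4 `B15TreeGaugeT0`: the chain `Λ = P⁰ ⊃ ⋯ ⊃ Pᵐ` of boxes of `ℤ^{n+3}` on one unit lattice, common threshold,
`ChainGeom`; the layers `Pⁱ∖Pⁱ⁺¹`, their union `B0` = the sites of `𝐁₀`; the `T₀`-paths `t0word` and the gauge
transformation `t0GaugeFn V = (x ↦ V(T₀-path to x))`; the gauge conditions `T0Gauge`: `V′ = 1` along every `Γ^i_{yⁱ,x}` and
on the external bonds).  §1 `T0Hyp` = a `U1`-valued field `U` whose plaquettes with corners in `𝐁₀` are `ε`-small; THE CORE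
ESTIMATE **`T0Hyp.norm_gauge_bond_sub_one_le`**: in the `T₀` gauge EVERY bond `b = ⟨x, x + e_μ⟩` with both ends in `𝐁₀` has
`‖U^v(b) − 1‖ ≤ ((d² + 7)W² + dW)·ε` (`W + 1` = sites per side of `Λ`, `d = n + 3`).  Proof: a unit bond joins equal or
consecutive layers (`ChainGeom.level_le_succ`); on layer `i` the `T₀` gauge function is `gᵢ·vᵢ` with `vᵢ` the single-
annulus gauge of PART 2 and `gᵢ = U(chainWord i)` constant (`t0GaugeFn_eq_mul`), so for a bond inside layer `i`, `U^v(b) =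
gᵢ U^{vᵢ}(b) gᵢ⁻¹` and PART 2's `norm_bond_sub_one_le` on the pair `(Pⁱ, Pⁱ⁺¹)` gives `(5W² + dW)ε` (`norm_sameLevel`); for
a bond from layer `i` to layer `i+1`, the SAME `vᵢ` is the single-annulus gauge of the MERGED pair `(Pⁱ, Pⁱ⁺²)` (the contours
do not depend on the inner box; `ChainGeom.geom_merge`), the `T₀` gauge function at the inner end is `gᵢ·ρ·vᵢ(x′)` with `ρ =
U(treeWord(yⁱ⁺¹ − yⁱ) ∪ Γ^{i+1}_{x′})·U(Γ^{i}_{x′})⁻¹`, whence `U^v(b) = gᵢ[U^{vᵢ}(b)ρ⁻¹]gᵢ⁻¹` (or `gᵢ[ρU^{vᵢ}(b)]gᵢ⁻¹`),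
bounded by PART 2 on the merged pair plus PART 5's two-level comparison `norm_levelChange_sub_one_le` (`(d² + 2)W²ε`):
`norm_levelUp`, `norm_levelDown`.  §2 `RegHypT0` = the printed situation on the whole chain (*"the regularity conditions for
V″, V₀"*: `ε″`-small plaquettes of `V″ = V′V₀` and `ε₀`-small plaquettes of `V₀` on `𝐁₀`; *"the gauge fixing for V′"*:
`T0Gauge`) and **`RegHypT0.norm_fluct_sub_one_le`**: `‖V′(b) − 1‖ ≤ ((d² + 7)W² + dW)(ε″ + ε₀)` for EVERY bond `b` with both
ends in `𝐁₀` — via `fluct_eq_conj` (generation 4) with `v = t0GaugeFn V₀ = t0GaugeFn V″` on `𝐁₀` (`T0Gauge.t0GaugeFn_mulCfg`);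
the strict printed-style shape `norm_fluct_sub_one_lt` (`< (d² + 8)D²(ε″ + ε₀)`, `D ≥ W + 1` sites per side, `d ≤ D`); §3
the dictionary **`RegHypT0.ineqV196`** = `B15.PrelimIntegrations.IneqV196 ‖V′(b) − 1‖ (10⁴(d² + 8)K) M N R_k ε_k` BY NAME under
`D = 100MR_k` (condition (i) p. 177) and the packaging hypothesis `ε″ + ε₀ ≤ K·N·R_k²·ε_k` of generation 4.

HONEST SCOPE / DEVIATIONS.  (1) SINGLE-SCALE MODEL of the chain (PART 4; r12's `B15TreeGraph196` §8): in print consecutive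
layers live on lattices of different scales (*"they are L-bonds for the unit scale in P₁"*); one common threshold `a`; the
additional `Λ`-bond `[(y₁ − 1, …), y]` is omitted (it multiplies `v` by a constant).  (2) `U1 𝔸`-valued fields (`⊇ U(N)`,
operator norm), `≤`-hypotheses, `d = n + 3 ≥ 3`.  (3) The constant `(d² + 7)W² + dW` (hence `O(1) = 10⁴(d² + 8)K` in the
typed leaf, `d = 4` in print) is this proof's; the print gives none.  Nothing is weakened: the typed leaf is discharged AS
TYPED for the model's `dev = ‖V′(b) − 1‖`, now for every bond of `𝐁₀`.  Every declaration is a definition with a body or a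
proved theorem; nothing of [IV] is asserted as a hypothesis-free fact.  Unit `lit-balaban-p26` (literature-prover-lit-
balaban-p26-g5-0).
-/

noncomputable section

open scoped BigOperators

namespace Literature.MathematicalPhysics.QuantumFieldTheory.Balaban1983to89.B15TreeGauge196

open B7Prop1Explicit B8Lemma1NonAbelian B16Ineq382

variable {n : ℕ} {𝔸 : Type*} [NormedRing 𝔸] [NormOneClass 𝔸]

/-! ## §1 A field with small plaquettes on `𝐁₀` in the `T₀` gauge -/

section Core

/-- The situation of PART 2's `Case1Hyp` on the whole chain: the chain geometry, sides of `Λ` of at most `W + 1` sites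
(condition (i) of p. 177), a `U1`-valued bond field `U` whose plaquettes with corners in `𝐁₀` deviate from `1` by at most
`ε`. [cite: Balaban1989LargeFieldI, p.196 (bound on V′)] -/
structure T0Hyp (lo hi : ℕ → Site (n + 3)) (τ : ℤ) (m W : ℕ) (U : Site (n + 3) → Fin (n + 3) → 𝔸ˣ) (ε : ℝ) :
    Prop where
  chain : ChainGeom lo hi τ m
  width : ∀ κ, hi 0 κ - lo 0 κ ≤ W
  unit : ∀ x κ, U x κ ∈ U1 𝔸
  eps_nonneg : 0 ≤ ε
  plaq : B16Ineq382.PlaqSmallOn (B0 lo hi m) U ε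

variable {lo hi : ℕ → Site (n + 3)} {τ : ℤ} {m W : ℕ} {U : Site (n + 3) → Fin (n + 3) → 𝔸ˣ} {ε : ℝ}

/-- PART 2's hypotheses for the gauge-fixed field `U^{vᵢ}` of the pair `(Pⁱ, Pⁱ⁺¹)`. [cite: Balaban1989LargeFieldI, p.196 (bound on V′)] -/
theorem T0Hyp.case1Hyp_level (H : T0Hyp lo hi τ m W U ε) {i : ℕ} (him : i < m) :
    Case1Hyp (lo i) (hi i) (lo (i + 1)) (hi (i + 1)) τ W (gaugeAct (treeGaugeFn U (lo i) (hi i) τ) U) ε :=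
  case1Hyp_gaugeFixed (H.chain.geom i him) (fun κ => H.chain.width_le H.width him.le κ) H.unit H.eps_nonneg
    (H.plaq.mono (layer_subset_B0 him))

/-- PART 2's hypotheses for the SAME gauge-fixed field `U^{vᵢ}` on the merged pair `(Pⁱ, Pⁱ⁺²)` (the contours `Γ^i_{yⁱ,x}`
do not depend on the inner box). [cite: Balaban1989LargeFieldI, p.196 (bound on V′)] -/
theorem T0Hyp.case1Hyp_merge (H : T0Hyp lo hi τ m W U ε) {i : ℕ} (him : i + 1 < m) :
    Case1Hyp (lo i) (hi i) (lo (i + 2)) (hi (i + 2)) τ W (gaugeAct (treeGaugeFn U (lo i) (hi i) τ) U) ε :=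
  case1Hyp_gaugeFixed (H.chain.geom_merge him) (fun κ => H.chain.width_le H.width (by omega : i ≤ m) κ) H.unit
    H.eps_nonneg (H.plaq.mono (ann_merge_subset_B0 him))

/-- Gauge functions that agree at the two ends of a bond up to a constant left factor give conjugate bond variables.
[cite: Balaban1985Averaging, (8) p.18] -/
theorem gaugeAct_eq_conj_of_eq {G : Type*} [Group G] {v w : Site (n + 3) → G} {g : G} (V : Site (n + 3) → Fin (n + 3) → G)
    {x : Site (n + 3)} {μ : Fin (n + 3)} (hx : w x = g * v x) (hx' : w (x + e μ) = g * v (x + e μ)) :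
    gaugeAct w V x μ = g * gaugeAct v V x μ * g⁻¹ := by
  simp only [gaugeAct, hx, hx']
  group

/-- **Bonds inside one layer**: `‖U^v(b) − 1‖ ≤ (5W² + dW)ε` for `b = ⟨x, x + e_μ⟩` with both ends in `Pⁱ∖Pⁱ⁺¹` — `U^v(b) =
gᵢ U^{vᵢ}(b) gᵢ⁻¹` and PART 2 on the pair `(Pⁱ, Pⁱ⁺¹)`. [cite: Balaban1989LargeFieldI, p.196 (bound on V′)] -/
theorem T0Hyp.norm_sameLevel (H : T0Hyp lo hi τ m W U ε) {i : ℕ} (him : i < m) {x : Site (n + 3)} {μ : Fin (n + 3)}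
    (hx : x ∈ layer lo hi i) (hx' : x + e μ ∈ layer lo hi i) :
    ‖((gaugeAct (t0GaugeFn U lo hi τ) U x μ : 𝔸ˣ) : 𝔸) - 1‖ ≤ (5 * (W : ℝ) ^ 2 + (n + 3) * W) * ε := by
  rw [gaugeAct_eq_conj_of_eq U (H.chain.t0GaugeFn_eq_mul U him hx) (H.chain.t0GaugeFn_eq_mul U him hx'), Units.val_mul,
    Units.val_mul]
  exact (norm_units_conj_sub_one_le (hol_mem H.unit _ _) _).trans (norm_bond_sub_one_le (H.case1Hyp_level him) hx hx')

/-- The `T₀` gauge function at a site `x′` of the next layer: `v(x′) = gᵢ · ρ · vᵢ(x′)` with the two-level ratio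
`ρ = U(treeWord(yⁱ⁺¹ − yⁱ) ∪ Γ^{i+1}_{x′}) · U(Γ^{i}_{x′})⁻¹`. [cite: Balaban1989LargeFieldI, p.196 (bound on V′)] -/
theorem ChainGeom.t0GaugeFn_eq_mul_ratio {G : Type*} [Group G] (hC : ChainGeom lo hi τ m) (V : Site (n + 3) → Fin (n + 3) → G)
    {i : ℕ} (him : i + 1 < m) {x' : Site (n + 3)} (hx' : x' ∈ layer lo hi (i + 1)) :
    t0GaugeFn V lo hi τ x' = hol V (lo 0) (chainWord lo i) *
      (hol V (lo i) (treeWord (lo (i + 1) - lo i) ++ contour (lo (i + 1)) (hi (i + 1)) τ x') *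
        (hol V (lo i) (contour (lo i) (hi i) τ x'))⁻¹) * treeGaugeFn V (lo i) (hi i) τ x' := by
  rw [hC.t0GaugeFn_eq_mul V him hx', hol_chainWord_succ, treeGaugeFn, treeGaugeFn, hol_append, disp_treeWord,
    add_sub_cancel]
  group

/-- **Bonds from layer `i` to layer `i+1`**: `‖U^v(b) − 1‖ ≤ ((d² + 7)W² + dW)ε` — `U^v(b) = gᵢ[U^{vᵢ}(b)·ρ⁻¹]gᵢ⁻¹`, PART 2
on the merged pair `(Pⁱ, Pⁱ⁺²)` and PART 5's two-level comparison. [cite: Balaban1989LargeFieldI, p.196 (bound on V′)] -/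
theorem T0Hyp.norm_levelUp (H : T0Hyp lo hi τ m W U ε) {i : ℕ} (him : i + 1 < m) {x : Site (n + 3)} {μ : Fin (n + 3)}
    (hx : x ∈ layer lo hi i) (hx' : x + e μ ∈ layer lo hi (i + 1)) :
    ‖((gaugeAct (t0GaugeFn U lo hi τ) U x μ : 𝔸ˣ) : 𝔸) - 1‖ ≤
      ((((n : ℝ) + 3) ^ 2 + 7) * (W : ℝ) ^ 2 + (n + 3) * W) * ε := by
  set g := hol U (lo 0) (chainWord lo i) with hg
  set v := treeGaugeFn U (lo i) (hi i) τ with hv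
  set ρ := hol U (lo i) (treeWord (lo (i + 1) - lo i) ++ contour (lo (i + 1)) (hi (i + 1)) τ (x + e μ)) *
    (hol U (lo i) (contour (lo i) (hi i) τ (x + e μ)))⁻¹ with hρ
  have h1 : t0GaugeFn U lo hi τ x = g * v x := H.chain.t0GaugeFn_eq_mul U (by omega) hx
  have h2 : t0GaugeFn U lo hi τ (x + e μ) = g * ρ * v (x + e μ) := H.chain.t0GaugeFn_eq_mul_ratio U him hx'
  have hid : gaugeAct (t0GaugeFn U lo hi τ) U x μ = g * (gaugeAct v U x μ * ρ⁻¹) * g⁻¹ := by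
    simp only [gaugeAct, h1, h2]; group
  have hgU : g ∈ U1 𝔸 := hol_mem H.unit _ _
  have hρU : ρ ∈ U1 𝔸 := (U1 𝔸).mul_mem (hol_mem H.unit _ _) ((U1 𝔸).inv_mem (hol_mem H.unit _ _))
  have hA : ‖((gaugeAct v U x μ : 𝔸ˣ) : 𝔸) - 1‖ ≤ (5 * (W : ℝ) ^ 2 + (n + 3) * W) * ε :=
    norm_bond_sub_one_le (H.case1Hyp_merge him) (H.chain.layer_subset_ann_merge him hx)
      (H.chain.layer_succ_subset_ann_merge him hx')
  have hB : ‖((ρ : 𝔸ˣ) : 𝔸) - 1‖ ≤ (((n : ℝ) + 3) ^ 2 + 2) * (W : ℝ) ^ 2 * ε :=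
    norm_levelChange_sub_one_le (H.chain.geom i (by omega)) (H.chain.geom (i + 1) him)
      (fun κ => H.chain.width_le H.width (by omega : i ≤ m) κ) H.unit H.eps_nonneg
      (H.plaq.mono (ann_merge_subset_B0 him)) hx'
  rw [hid, Units.val_mul, Units.val_mul]
  refine (norm_units_conj_sub_one_le hgU _).trans ?_
  refine (norm_units_mul_sub_one_le ((H.case1Hyp_merge him).unit x μ)).trans ?_
  have := norm_inv_sub_one_le hρU
  linarith [hA, hB, this]

/-- **Bonds from layer `i+1` to layer `i`**: the same bound — `U^v(b) = gᵢ[ρ·U^{vᵢ}(b)]gᵢ⁻¹`. [cite: Balaban1989LargeFieldI, p.196 (bound on V′)] -/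
theorem T0Hyp.norm_levelDown (H : T0Hyp lo hi τ m W U ε) {i : ℕ} (him : i + 1 < m) {x : Site (n + 3)} {μ : Fin (n + 3)}
    (hx : x ∈ layer lo hi (i + 1)) (hx' : x + e μ ∈ layer lo hi i) :
    ‖((gaugeAct (t0GaugeFn U lo hi τ) U x μ : 𝔸ˣ) : 𝔸) - 1‖ ≤
      ((((n : ℝ) + 3) ^ 2 + 7) * (W : ℝ) ^ 2 + (n + 3) * W) * ε := by
  set g := hol U (lo 0) (chainWord lo i) with hg
  set v := treeGaugeFn U (lo i) (hi i) τ with hv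
  set ρ := hol U (lo i) (treeWord (lo (i + 1) - lo i) ++ contour (lo (i + 1)) (hi (i + 1)) τ x) *
    (hol U (lo i) (contour (lo i) (hi i) τ x))⁻¹ with hρ
  have h1 : t0GaugeFn U lo hi τ x = g * ρ * v x := H.chain.t0GaugeFn_eq_mul_ratio U him hx
  have h2 : t0GaugeFn U lo hi τ (x + e μ) = g * v (x + e μ) := H.chain.t0GaugeFn_eq_mul U (by omega) hx'
  have hid : gaugeAct (t0GaugeFn U lo hi τ) U x μ = g * (ρ * gaugeAct v U x μ) * g⁻¹ := by
    simp only [gaugeAct, h1, h2]; group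
  have hgU : g ∈ U1 𝔸 := hol_mem H.unit _ _
  have hρU : ρ ∈ U1 𝔸 := (U1 𝔸).mul_mem (hol_mem H.unit _ _) ((U1 𝔸).inv_mem (hol_mem H.unit _ _))
  have hA : ‖((gaugeAct v U x μ : 𝔸ˣ) : 𝔸) - 1‖ ≤ (5 * (W : ℝ) ^ 2 + (n + 3) * W) * ε :=
    norm_bond_sub_one_le (H.case1Hyp_merge him) (H.chain.layer_succ_subset_ann_merge him hx)
      (H.chain.layer_subset_ann_merge him hx')
  have hB : ‖((ρ : 𝔸ˣ) : 𝔸) - 1‖ ≤ (((n : ℝ) + 3) ^ 2 + 2) * (W : ℝ) ^ 2 * ε :=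
    norm_levelChange_sub_one_le (H.chain.geom i (by omega)) (H.chain.geom (i + 1) him)
      (fun κ => H.chain.width_le H.width (by omega : i ≤ m) κ) H.unit H.eps_nonneg
      (H.plaq.mono (ann_merge_subset_B0 him)) hx
  rw [hid, Units.val_mul, Units.val_mul]
  refine (norm_units_conj_sub_one_le hgU _).trans ?_
  refine (norm_units_mul_sub_one_le hρU).trans ?_
  linarith [hA, hB]

/-- **THE CORE ESTIMATE: every bond of `𝐁₀` in the `T₀` gauge.**  For a `U1`-valued `U` with `ε`-small plaquettes on `𝐁₀`
and the `T₀` gauge transformation `v(x) = U(T₀-path to x)`, every bond `b = ⟨x, x + e_μ⟩` with `x ∈ Pⁱ∖Pⁱ⁺¹`, `x + e_μ ∈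
Pʲ∖Pʲ⁺¹` (`i, j < m`) has `‖U^v(b) − 1‖ ≤ ((d² + 7)W² + dW)·ε` (`j ∈ {i − 1, i, i + 1}` by the geometry of the chain).
[cite: Balaban1989LargeFieldI, p.196 (bound on V′)] -/
theorem T0Hyp.norm_gauge_bond_sub_one_le (H : T0Hyp lo hi τ m W U ε) {i j : ℕ} (him : i < m) (hjm : j < m)
    {x : Site (n + 3)} {μ : Fin (n + 3)} (hx : x ∈ layer lo hi i) (hx' : x + e μ ∈ layer lo hi j) :
    ‖((gaugeAct (t0GaugeFn U lo hi τ) U x μ : 𝔸ˣ) : 𝔸) - 1‖ ≤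
      ((((n : ℝ) + 3) ^ 2 + 7) * (W : ℝ) ^ 2 + (n + 3) * W) * ε := by
  have hε := H.eps_nonneg
  have hclose : ∀ κ, x κ - 1 ≤ (x + e μ) κ ∧ (x + e μ) κ ≤ x κ + 1 := fun κ => by
    simp only [Pi.add_apply, e_apply]; split_ifs <;> constructor <;> omega
  have hclose' : ∀ κ, (x + e μ) κ - 1 ≤ x κ ∧ x κ ≤ (x + e μ) κ + 1 := fun κ => by
    simp only [Pi.add_apply, e_apply]; split_ifs <;> constructor <;> omega
  have hji : j ≤ i + 1 := H.chain.level_le_succ him hjm hx hx' hclose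
  have hij : i ≤ j + 1 := H.chain.level_le_succ hjm him hx' hx hclose'
  have hmono : (5 * (W : ℝ) ^ 2 + (n + 3) * W) * ε ≤ ((((n : ℝ) + 3) ^ 2 + 7) * (W : ℝ) ^ 2 + (n + 3) * W) * ε := by
    apply mul_le_mul_of_nonneg_right _ hε
    nlinarith [sq_nonneg (W : ℝ), sq_nonneg ((n : ℝ) + 3)]
  rcases Nat.lt_trichotomy j i with hlt | rfl | hgt
  · obtain rfl : i = j + 1 := by omega
    exact H.norm_levelDown him hx hx'
  · exact (H.norm_sameLevel him hx hx').trans hmono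
  · obtain rfl : j = i + 1 := by omega
    exact H.norm_levelUp hjm hx hx'

/-- The core estimate for two sites of `𝐁₀`. [cite: Balaban1989LargeFieldI, p.196 (bound on V′)] -/
theorem T0Hyp.norm_gauge_bond_sub_one_le_B0 (H : T0Hyp lo hi τ m W U ε) {x : Site (n + 3)} {μ : Fin (n + 3)}
    (hx : x ∈ B0 lo hi m) (hx' : x + e μ ∈ B0 lo hi m) :
    ‖((gaugeAct (t0GaugeFn U lo hi τ) U x μ : 𝔸ˣ) : 𝔸) - 1‖ ≤
      ((((n : ℝ) + 3) ^ 2 + 7) * (W : ℝ) ^ 2 + (n + 3) * W) * ε := by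
  obtain ⟨i, him, hxi⟩ := hx
  obtain ⟨j, hjm, hxj⟩ := hx'
  exact H.norm_gauge_bond_sub_one_le him hjm hxi hxj

end Core

/-! ## §2 The claim of p. 196 for `V′` on all of `𝐁₀` -/

section Claim

/-- **[IV] p. 196: "The regularity conditions for V″, V₀, and the gauge fixing for V′"** on the whole chain `Λ = P⁰ ⊃ ⋯ ⊃
Pᵐ` in the variables of (1.81) `V″ = V′V₀`: the chain geometry, sides of `Λ` of at most `W + 1` sites, `U1`-valued `V′`,
`V₀`; the plaquettes of `V″ = V′V₀` with corners in `𝐁₀` deviate from `1` by `≤ ε″` and those of `V₀` by `≤ ε₀`; and the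
tree gauge `T₀`: `V′ = 1` along every contour of every layer and on the external bonds.
[cite: Balaban1989LargeFieldI, p.196 (bound on V′)] -/
structure RegHypT0 (lo hi : ℕ → Site (n + 3)) (τ : ℤ) (m W : ℕ) (V' V₀ : Site (n + 3) → Fin (n + 3) → 𝔸ˣ)
    (ε'' ε₀ : ℝ) : Prop where
  chain : ChainGeom lo hi τ m
  width : ∀ κ, hi 0 κ - lo 0 κ ≤ W
  unit' : ∀ x κ, V' x κ ∈ U1 𝔸
  unit₀ : ∀ x κ, V₀ x κ ∈ U1 𝔸
  eps''_nonneg : 0 ≤ ε''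
  eps₀_nonneg : 0 ≤ ε₀
  plaq'' : B16Ineq382.PlaqSmallOn (B0 lo hi m) (mulCfg V' V₀) ε''
  plaq₀ : B16Ineq382.PlaqSmallOn (B0 lo hi m) V₀ ε₀
  tree : T0Gauge V' lo hi τ m

variable {lo hi : ℕ → Site (n + 3)} {τ : ℤ} {m W : ℕ} {V' V₀ : Site (n + 3) → Fin (n + 3) → 𝔸ˣ} {ε'' ε₀ : ℝ}

/-- `V″ = V′V₀` satisfies §1's hypotheses with `ε″`. [cite: Balaban1989LargeFieldI, p.196 (bound on V′)] -/
theorem RegHypT0.t0Hyp'' (H : RegHypT0 lo hi τ m W V' V₀ ε'' ε₀) : T0Hyp lo hi τ m W (mulCfg V' V₀) ε'' :=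
  ⟨H.chain, H.width, mulCfg_mem H.unit' H.unit₀, H.eps''_nonneg, H.plaq''⟩

/-- `V₀` satisfies §1's hypotheses with `ε₀`. [cite: Balaban1989LargeFieldI, p.196 (bound on V′)] -/
theorem RegHypT0.t0Hyp₀ (H : RegHypT0 lo hi τ m W V' V₀ ε'' ε₀) : T0Hyp lo hi τ m W V₀ ε₀ :=
  ⟨H.chain, H.width, H.unit₀, H.eps₀_nonneg, H.plaq₀⟩

/-- **[IV] p. 196, the claim "|V′ − 1| < O(1)M²NR_k⁴ε_k on 𝐁₀", object level on ALL of `𝐁₀`** (single-scale model,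
explicit constant): in the situation `RegHypT0`, every bond `b = ⟨x, x + e_μ⟩` with both ends in `𝐁₀` satisfies `‖V′(b) − 1‖
≤ ((d² + 7)W² + dW)(ε″ + ε₀)`.  Proof: `V′(b) = v(x)⁻¹·[(V′V₀)^v(b)·(V₀^v(b))⁻¹]·v(x)` (`fluct_eq_conj`) with `v` the `T₀`
gauge function of `V₀`, which on `𝐁₀` is also that of `V″ = V′V₀` (`T0Gauge.t0GaugeFn_mulCfg`); both gauge-fixed factors are
controlled by §1. [cite: Balaban1989LargeFieldI, p.196 (bound on V′)] -/
theorem RegHypT0.norm_fluct_sub_one_le (H : RegHypT0 lo hi τ m W V' V₀ ε'' ε₀) {x : Site (n + 3)} {μ : Fin (n + 3)}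
    (hx : x ∈ B0 lo hi m) (hx' : x + e μ ∈ B0 lo hi m) :
    ‖((V' x μ : 𝔸ˣ) : 𝔸) - 1‖ ≤ ((((n : ℝ) + 3) ^ 2 + 7) * (W : ℝ) ^ 2 + (n + 3) * W) * (ε'' + ε₀) := by
  obtain ⟨i, him, hxi⟩ := hx
  obtain ⟨j, hjm, hxj⟩ := hx'
  set v := t0GaugeFn V₀ lo hi τ with hv
  have hvx : v x ∈ U1 𝔸 := hol_mem H.unit₀ _ _
  set A := gaugeAct v (mulCfg V' V₀) x μ with hA
  set B := gaugeAct v V₀ x μ with hB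
  -- `A` is the bond variable of `V″` in ITS `T₀` gauge (the two gauge functions agree at `x` and `x + e_μ`)
  have hAeq : A = gaugeAct (t0GaugeFn (mulCfg V' V₀) lo hi τ) (mulCfg V' V₀) x μ := by
    simp only [hA, gaugeAct, hv, H.tree.t0GaugeFn_mulCfg H.chain him hxi, H.tree.t0GaugeFn_mulCfg H.chain hjm hxj]
  have hAle : ‖(A : 𝔸) - 1‖ ≤ ((((n : ℝ) + 3) ^ 2 + 7) * (W : ℝ) ^ 2 + (n + 3) * W) * ε'' := by
    rw [hAeq]; exact H.t0Hyp''.norm_gauge_bond_sub_one_le him hjm hxi hxj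
  have hBle : ‖(B : 𝔸) - 1‖ ≤ ((((n : ℝ) + 3) ^ 2 + 7) * (W : ℝ) ^ 2 + (n + 3) * W) * ε₀ :=
    H.t0Hyp₀.norm_gauge_bond_sub_one_le him hjm hxi hxj
  have hAU : A ∈ U1 𝔸 := gaugeAct_mem (mulCfg_mem H.unit' H.unit₀) (fun _ => hol_mem H.unit₀ _ _) x μ
  have hBU : B ∈ U1 𝔸 := gaugeAct_mem H.unit₀ (fun _ => hol_mem H.unit₀ _ _) x μ
  have hBinv : ‖((B⁻¹ : 𝔸ˣ) : 𝔸) - 1‖ ≤ ‖(B : 𝔸) - 1‖ := norm_inv_sub_one_le hBU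
  have hAB : ‖((A * B⁻¹ : 𝔸ˣ) : 𝔸) - 1‖ ≤ ‖(A : 𝔸) - 1‖ + ‖((B⁻¹ : 𝔸ˣ) : 𝔸) - 1‖ := norm_units_mul_sub_one_le hAU
  have hconj : ‖(((v x)⁻¹ : 𝔸ˣ) : 𝔸) * ((A * B⁻¹ : 𝔸ˣ) : 𝔸) * ((v x : 𝔸ˣ) : 𝔸) - 1‖ ≤ ‖((A * B⁻¹ : 𝔸ˣ) : 𝔸) - 1‖ :=
    norm_units_inv_conj_sub_one_le hvx _
  have heq : ((V' x μ : 𝔸ˣ) : 𝔸) = (((v x)⁻¹ : 𝔸ˣ) : 𝔸) * ((A * B⁻¹ : 𝔸ˣ) : 𝔸) * ((v x : 𝔸ˣ) : 𝔸) := by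
    rw [← Units.val_mul, ← Units.val_mul, ← fluct_eq_conj v V' V₀ x μ]
  rw [heq]
  have hsum : ((((n : ℝ) + 3) ^ 2 + 7) * (W : ℝ) ^ 2 + (n + 3) * W) * ε'' +
      ((((n : ℝ) + 3) ^ 2 + 7) * (W : ℝ) ^ 2 + (n + 3) * W) * ε₀ =
      ((((n : ℝ) + 3) ^ 2 + 7) * (W : ℝ) ^ 2 + (n + 3) * W) * (ε'' + ε₀) := by ring
  linarith

/-- **Printed-style strict shape**: with `D ≥ W + 1` sites per side (condition (i) of p. 177: `D = 100MR_k`), `d ≤ D` and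
`0 < ε″ + ε₀`, every bond of `𝐁₀` has `‖V′(b) − 1‖ < (d² + 8)D²(ε″ + ε₀)`. [cite: Balaban1989LargeFieldI, p.196 (bound on V′)] -/
theorem RegHypT0.norm_fluct_sub_one_lt (H : RegHypT0 lo hi τ m W V' V₀ ε'' ε₀) {D : ℝ} (hD : (W : ℝ) + 1 ≤ D)
    (hd : (n : ℝ) + 3 ≤ D) (hε : 0 < ε'' + ε₀) {x : Site (n + 3)} {μ : Fin (n + 3)} (hx : x ∈ B0 lo hi m)
    (hx' : x + e μ ∈ B0 lo hi m) :
    ‖((V' x μ : 𝔸ˣ) : 𝔸) - 1‖ < (((n : ℝ) + 3) ^ 2 + 8) * D ^ 2 * (ε'' + ε₀) := by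
  refine (H.norm_fluct_sub_one_le hx hx').trans_lt (mul_lt_mul_of_pos_right ?_ hε)
  have hW : (0 : ℝ) ≤ W := Nat.cast_nonneg W
  have hn : (0 : ℝ) ≤ n := Nat.cast_nonneg n
  have hD0 : (0 : ℝ) ≤ D := by linarith
  have h1 : (W : ℝ) * W < D * D := by nlinarith
  have h2 : ((n : ℝ) + 3) * W ≤ D * D := mul_le_mul hd (by linarith) hW hD0
  have h3 : 0 ≤ ((n : ℝ) + 3) ^ 2 + 7 := by positivity
  nlinarith [mul_le_mul_of_nonneg_left h1.le h3, h1, h2]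

/-! ## §3 Dictionary to the typed row `B15.PrelimIntegrations.IneqV196` -/

/-- **The row's typed leaf, discharged by name on all of `𝐁₀`** (single-scale model): with `D = 100·M·R_k` sites per side
(p. 177 (i): *"it is contained in a cube of the size 100MR_k"*), `d ≤ 100MR_k`, and the two regularity inputs packaged as
`ε″ + ε₀ ≤ K·N·R_k²·ε_k` (`0 < K`, `N ≥ 1`, `R_k, ε_k > 0`), every bond `b` with both ends in `𝐁₀` satisfies
`B15.PrelimIntegrations.IneqV196 ‖V′(b) − 1‖ (10⁴(d² + 8)K) M N R_k ε_k`, i.e. the printed `|V′(b) − 1| < O(1)M²NR_k⁴ε_k`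
with `O(1) = 10⁴(d² + 8)K`. [cite: Balaban1989LargeFieldI, p.196 (bound on V′)] -/
theorem RegHypT0.ineqV196 (H : RegHypT0 lo hi τ m W V' V₀ ε'' ε₀) {M Rk N εk K : ℝ}
    (hD : (W : ℝ) + 1 ≤ 100 * M * Rk) (hd : (n : ℝ) + 3 ≤ 100 * M * Rk) (hK : 0 < K) (hN : 1 ≤ N) (hRk : 0 < Rk)
    (hεk : 0 < εk) (hreg : ε'' + ε₀ ≤ K * N * Rk ^ 2 * εk) {x : Site (n + 3)} {μ : Fin (n + 3)}
    (hx : x ∈ B0 lo hi m) (hx' : x + e μ ∈ B0 lo hi m) :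
    B15.PrelimIntegrations.IneqV196 ‖((V' x μ : 𝔸ˣ) : 𝔸) - 1‖ (10000 * (((n : ℝ) + 3) ^ 2 + 8) * K) M N Rk εk := by
  unfold B15.PrelimIntegrations.IneqV196
  have hle := H.norm_fluct_sub_one_le hx hx'
  have hW : (0 : ℝ) ≤ W := Nat.cast_nonneg W
  have hn : (0 : ℝ) ≤ n := Nat.cast_nonneg n
  set D : ℝ := 100 * M * Rk with hDdef
  have hD0 : (0 : ℝ) ≤ D := by linarith
  have h1 : (W : ℝ) * W < D * D := by nlinarith
  have h2 : ((n : ℝ) + 3) * W ≤ D * D := mul_le_mul hd (by linarith) hW hD0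
  have h3 : 0 ≤ ((n : ℝ) + 3) ^ 2 + 7 := by positivity
  -- `((d² + 7)W² + dW) < (d² + 8)D²`
  have hcoef : (((n : ℝ) + 3) ^ 2 + 7) * (W : ℝ) ^ 2 + (n + 3) * W < (((n : ℝ) + 3) ^ 2 + 8) * D ^ 2 := by
    nlinarith [mul_le_mul_of_nonneg_left h1.le h3, h1, h2]
  have hpos : 0 < K * N * Rk ^ 2 * εk := by positivity
  have h4 : ((((n : ℝ) + 3) ^ 2 + 7) * (W : ℝ) ^ 2 + (n + 3) * W) * (ε'' + ε₀) ≤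
      ((((n : ℝ) + 3) ^ 2 + 7) * (W : ℝ) ^ 2 + (n + 3) * W) * (K * N * Rk ^ 2 * εk) :=
    mul_le_mul_of_nonneg_left hreg (by positivity)
  have h5 : ((((n : ℝ) + 3) ^ 2 + 7) * (W : ℝ) ^ 2 + (n + 3) * W) * (K * N * Rk ^ 2 * εk) <
      (((n : ℝ) + 3) ^ 2 + 8) * D ^ 2 * (K * N * Rk ^ 2 * εk) := mul_lt_mul_of_pos_right hcoef hpos
  have h6 : (((n : ℝ) + 3) ^ 2 + 8) * D ^ 2 * (K * N * Rk ^ 2 * εk) =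
      10000 * (((n : ℝ) + 3) ^ 2 + 8) * K * M ^ 2 * N * Rk ^ 4 * εk := by rw [hDdef]; ring
  linarith

end Claim

end Literature.MathematicalPhysics.QuantumFieldTheory.Balaban1983to89.B15TreeGauge196
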